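import Literature.AlgebraicGeometry.Resolution.Hironaka1964LocalSingularLocus
import HarnessLib

/-!
# `Hironaka1964_local` reduces to desingularizing along a Cartier divisor of finite type over a field

Topic: `Literature/AlgebraicGeometry/Resolution`. Companion of `Hironaka1964LocalBlowups.lean` and
`Hironaka1964LocalSingularLocus.lean` (proofs only: no new notions, no new named facts). Recall
(`hironaka1964_local_iff_isBlowup_local`) that the named fact `Hironaka1964_local` — Hironaka
1964, Main Theorem I, over local quasi-excellent rings of residue characteristic zero, in the
reading of Temkin 2008 — is equivalent to the local desingularization problem

  (L) for every local quasi-excellent domain `S` whose residue field has characteristic zero,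
      every blow-up `g : S' → Spec S` along a nonzero ideal whose non-regular points lie over
      the closed point `s` admits a desingularization,

which Temkin's Hironaka-free proof (Thm. 3.4.3, p. 19) settles by Cor. 3.4.2 applied to the pair
`(S', S'_sing)` (`S'_sing` is of finite type over `k(s)`: `isBlowup_local_singularLocus_finiteType`).
The proof of Cor. 3.4.2 (p. 18–19) begins with a scheme-theoretic reduction: "The blow up
`Bl_Z(X) → X` is an isomorphism over `V = (X, Z)_reg` … `Bl_Z(X)` is dominated by a
`V`-admissible blow up `X' → X` [Lemma 2.1.5, Raynaud–Gruson], and then `Z' = Z ×_X X'` is a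
Cartier divisor in `X'`. Replacing `X` and `Z` with `X'` and `Z'`, we achieve that `Z` is a
Cartier divisor" — after which everything is formal geometry along the Cartier divisor `Z`
(completion, Thm. 3.4.1 on rig-regular special formal schemes, algebraization of the centre,
Lemma 2.1.8). In the non-embedded situation of (L) the flattening lemma is not needed: for
`Z = S'_sing` the blow-up `Bl_Z(S') → S'` is itself `S'_reg`-admissible. This file carries out
that reduction, sorry-free, so that the remaining (formal-geometric) content of Temkin's proof of
`Hironaka1964_local` is isolated as the single hypothesis

  (C) **the Cartier case**: for every integral Noetherian quasi-excellent scheme `X` whose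
      residue fields have characteristic zero and every effective Cartier divisor `D ⊆ X`
      (an ideal sheaf locally generated by a non-zero-divisor) which contains the singular
      locus `X ∖ Reg X` and is, as a closed subscheme, of finite type over some field, there is
      a blow-up `X'' → X` with centre supported in `D` and `X''` regular

— the output of Cor. 3.4.2's proof from its second paragraph on ("Let `𝔛` be the formal
completion of `X` along `Z` …"), with `Z = D` already Cartier.

* `isBlowup_local_of_cartier` — **(C) ⟹ (L)**: given `S'` as in (L), let `Z = S'_sing` with its
  reduced structure (closed, of finite type over `κ(s)`), `π : X' = Bl_Z(S') → S'`
  (`exists_isBlowup`) and `D = π⁻¹(Z)` the exceptional divisor (`IsBlowup.isEffectiveCartier`).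
  Then `X'` is integral (`Z ≠ S'` as the generic point is regular), Noetherian and
  quasi-excellent (of finite type over `S`, Stacks 07QU), with residue fields of characteristic
  zero; `X' ∖ D ≅ S' ∖ Z = S'_reg` (`IsBlowup.isIso_compl`), so `X'_sing ⊆ D`; and `D` is of
  finite type over `κ(s)` through `D → Z → Spec κ(s)` (`subschemeMap`). By (C) there is a blow-up
  `f : X'' → X'` centred in `D` with `X''` regular, and `f ≫ π` is a single blow-up of `S'`
  centred in `Z = S'_sing` (Temkin Lemma 2.1.4 = `IsBlowup.exists_isBlowup_comp_supported`):
  a desingularization of `S'`.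
* `hironaka1964_local_of_cartier` — **(C) ⟹ `Hironaka1964_local`**
  (with `hironaka1964_local_of_isBlowup_local`).

No named fact is introduced: (C) appears only as a hypothesis.

## Sources

* M. Temkin, *Desingularization of quasi-excellent schemes in characteristic zero*, Adv. Math.
  219 (2008) 488–522 = arXiv:math/0703678 (arXiv pagination): Lemma 2.1.4 (p. 7), Cor. 3.4.2 and
  its proof (p. 18–19), proof of Thm. 3.4.3 (p. 19). [Temkin2008]
* H. Hironaka, *Resolution of singularities of an algebraic variety over a field of
  characteristic zero I*, Ann. of Math. 79 (1964) 109–203, Main Theorem I. [Hironaka1964]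
* The Stacks Project, Tag 07QU. [StacksProject]
-/

noncomputable section

open CategoryTheory AlgebraicGeometry TopologicalSpace IsLocalRing

namespace Literature.AlgebraicGeometry.Resolution

universe u

/-- **The Cartier case (C) solves the local desingularization problem (L)** (Temkin 2008, proof
of Cor. 3.4.2, first paragraph, in the non-embedded situation of the proof of Thm. 3.4.3): for `S`
a local quasi-excellent domain with residue field `κ(s)` of characteristic zero and
`g : S' → Spec S` a blow-up along a nonzero ideal with `S'_sing` over the closed point, blow up
`Z = S'_sing` (reduced structure; closed, of finite type over `κ(s)`,
`exists_reducedSubscheme_finiteType_residueField`) to get `π : X' → S'` with exceptional divisor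
`D = π⁻¹(Z)` effective Cartier. The scheme `X'` is integral (`Z ≠ S'`: the generic point is
regular), Noetherian, quasi-excellent (of finite type over `S`, Stacks 07QU = `Stacks07QU_holds`)
with residue fields of characteristic zero; `π` is an isomorphism over `S' ∖ Z = S'_reg`
(`IsBlowup.isIso_compl`), so `X'_sing ⊆ D`; and `D → Z → Spec κ(s)` exhibits `D` as a
`κ(s)`-scheme of finite type. The Cartier case gives a blow-up `f : X'' → X'` centred in `D`
with `X''` regular, and `f ≫ π : X'' → S'` is a blow-up centred in `Z = S'_sing` (Lemma 2.1.4,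
`IsBlowup.exists_isBlowup_comp_supported`), i.e. a desingularization of `S'`.
[cite: Temkin2008, Cor. 3.4.2 (proof, p. 18–19), Thm. 3.4.3 (proof, p. 19), Lemma 2.1.4]
[cite: StacksProject, Tag 07QU] -/
theorem isBlowup_local_of_cartier
    (hC : ∀ (X : Scheme.{u}) [IsIntegral X] [IsNoetherian X], Scheme.IsQuasiExcellent X →
      (∀ x : X, CharZero (X.residueField x)) →
      ∀ (D : X.IdealSheafData), IsEffectiveCartier D →
        (Scheme.regularLocus X)ᶜ ⊆ (D.support : Set X) →
        (∃ (k : Type u) (_ : Field k) (q : D.subscheme ⟶ Spec (.of k)),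
            LocallyOfFiniteType q ∧ QuasiCompact q) →
        ∃ (X'' : Scheme.{u}) (f : X'' ⟶ X) (J : X.IdealSheafData),
          IsBlowup f J ∧ (J.support : Set X) ⊆ D.support ∧ Scheme.IsRegular X'')
    (S : Type u) [CommRing S] [IsLocalRing S] [IsDomain S] (hS : IsQuasiExcellentRing S)
    (h0 : CharZero (ResidueField S)) {S' : Scheme.{u}} {g : S' ⟶ Spec (.of S)}
    {I : (Spec (.of S)).IdealSheafData} (hg : IsBlowup g I) (hI : I ≠ ⊥)
    (hsing : ∀ s : S', s ∉ Scheme.regularLocus S' → g s = closedPoint S) :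
    Scheme.AdmitsDesingularization S' := by
  -- standing hypotheses on `S'`
  obtain ⟨hint, hnoeth, -, -⟩ := isBlowup_local_standing_hypotheses S hS h0 hg hI
  haveI : IsNoetherianRing S := hS.isNoetherianRing
  haveI : IsNoetherianRing (CommRingCat.of S) := ‹IsNoetherianRing S›
  haveI : CharZero (ResidueField S) := h0
  haveI : IsProper g := hg.isProper
  -- `Z = S'_sing`, closed, with reduced structure of finite type over `κ(s)`
  obtain ⟨hc, -⟩ := isBlowup_local_singularLocus_finiteType S hS hg hsing
  let T : Closeds S' := ⟨(Scheme.regularLocus S')ᶜ, hc⟩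
  obtain ⟨pZ, hpZ, -, -⟩ :=
    exists_reducedSubscheme_finiteType_residueField g T fun x hx => hsing x hx
  -- blow up `Z`
  obtain ⟨X', π, hπ⟩ := exists_isBlowup S' (Scheme.IdealSheafData.vanishingIdeal T)
  have hIZ : Scheme.IdealSheafData.vanishingIdeal T ≠ ⊥ := by
    intro h
    have hgen : genericPoint S' ∈ ((Scheme.IdealSheafData.vanishingIdeal T).support : Set S') := by
      rw [h, Scheme.IdealSheafData.support_bot]; trivial
    rw [Scheme.IdealSheafData.coe_support_vanishingIdeal] at hgen
    exact hgen (genericPoint_mem_regularLocus S')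
  haveI : IsIntegral X' := hπ.isIntegral hIZ
  haveI : IsProper π := hπ.isProper
  haveI : IsLocallyNoetherian X' := LocallyOfFiniteType.isLocallyNoetherian π
  haveI : CompactSpace X' := QuasiCompact.compactSpace_of_compactSpace π
  haveI : IsNoetherian X' := {}
  have hqe' : Scheme.IsQuasiExcellent X' :=
    Scheme.isQuasiExcellent_of_locallyOfFiniteType_of_isQuasiExcellentRing Stacks07QU_holds hS
      (π ≫ g)
  have hchar' : ∀ x : X', CharZero (X'.residueField x) :=
    charZero_residueField_of_over_local (π ≫ g)
  -- the exceptional divisor `D = π⁻¹(Z)`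
  set D : X'.IdealSheafData := (Scheme.IdealSheafData.vanishingIdeal T).comap π with hD
  have hDc : IsEffectiveCartier D := hπ.isEffectiveCartier
  have hDsupp : (D.support : Set X') = π ⁻¹' (T : Set S') := by
    rw [hD, Scheme.IdealSheafData.support_comap, TopologicalSpace.Closeds.coe_preimage,
      Scheme.IdealSheafData.coe_support_vanishingIdeal]
  -- `X' ∖ D ≅ S'_reg`, so the singular locus of `X'` lies in `D`
  have hsing' : (Scheme.regularLocus X')ᶜ ⊆ (D.support : Set X') := by
    intro x hx
    rw [hDsupp, Set.mem_preimage]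
    by_contra hxT
    have hreg : π x ∈ Scheme.regularLocus S' := not_not.mp hxT
    have hxU : π x ∈ (⟨((Scheme.IdealSheafData.vanishingIdeal T).support : Set S')ᶜ,
        (Scheme.IdealSheafData.vanishingIdeal T).support.isClosed.isOpen_compl⟩ : S'.Opens) := by
      change π x ∈ ((Scheme.IdealSheafData.vanishingIdeal T).support : Set S')ᶜ
      rw [Scheme.IdealSheafData.coe_support_vanishingIdeal]
      exact hxT
    haveI := hπ.isIso_compl
    exact hx ((mem_regularLocus_iff_of_isIso_morphismRestrict π _ x hxU).mpr hreg)
  -- `D` is of finite type over `κ(s)` through `D → Z → Spec κ(s)`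
  have hfin : ∃ (k : Type u) (_ : Field k) (q : D.subscheme ⟶ Spec (.of k)),
      LocallyOfFiniteType q ∧ QuasiCompact q := by
    let m : D.subscheme ⟶ (Scheme.IdealSheafData.vanishingIdeal T).subscheme :=
      Scheme.IdealSheafData.subschemeMap D (Scheme.IdealSheafData.vanishingIdeal T) π
        ((Scheme.IdealSheafData.vanishingIdeal T).le_map_comap π)
    have hm : m ≫ (Scheme.IdealSheafData.vanishingIdeal T).subschemeι = D.subschemeι ≫ π :=
      Scheme.IdealSheafData.subschemeMap_subschemeι _ _ _ _
    refine ⟨ResidueField S, inferInstance, m ≫ pZ, ?_, ?_⟩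
    · have : LocallyOfFiniteType ((m ≫ pZ) ≫ Spec.map (CommRingCat.ofHom (residue S))) := by
        rw [Category.assoc, hpZ, ← Category.assoc, hm, Category.assoc]
        infer_instance
      exact locallyOfFiniteType_of_comp _ (Spec.map (CommRingCat.ofHom (residue S)))
    · haveI : CompactSpace D.subscheme := QuasiCompact.compactSpace_of_compactSpace D.subschemeι
      exact (quasiCompact_iff_compactSpace _).mpr ‹_›
  -- the Cartier case, and composition of the two `S'_sing`-supported blow-ups (Lemma 2.1.4)
  obtain ⟨X'', f, J, hf, hJ, hreg⟩ := hC X' hqe' hchar' D hDc hsing' hfin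
  have hIZT : ((Scheme.IdealSheafData.vanishingIdeal T).support : Set S') ⊆ T :=
    (Scheme.IdealSheafData.coe_support_vanishingIdeal T).subset
  have hJT : (J.support : Set X') ⊆ π ⁻¹' (T : Set S') := hJ.trans hDsupp.subset
  obtain ⟨Q, hQ, hQT⟩ :=
    IsBlowup.exists_isBlowup_comp_supported π _ f J (T : Set S') hπ hIZT hf hJT
  exact ⟨X'', f ≫ π, ⟨Q, hQ, hQT⟩, hreg⟩

/-- **The Cartier case (C) implies `Hironaka1964_local`** (Temkin 2008: Thm. 3.4.3 ⇐ Prop. 2.3.4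
+ Cor. 3.4.2, whose proof reduces at once to a Cartier divisor `Z`): resolution of singularities
over every local quasi-excellent ring of residue characteristic zero (Hironaka 1964, Main
Theorem I, as read by Temkin) follows from the statement that an integral Noetherian
quasi-excellent scheme with residue fields of characteristic zero, regular off an effective
Cartier divisor `D` of finite type over a field, admits a blow-up centred in `D` with regular
source — by `hironaka1964_local_of_isBlowup_local` and `isBlowup_local_of_cartier`.
[cite: Temkin2008, Thm. 3.4.3, Cor. 3.4.2, Prop. 2.3.4] [cite: Hironaka1964, Main Theorem I] -/
theorem hironaka1964_local_of_cartier
    (hC : ∀ (X : Scheme.{u}) [IsIntegral X] [IsNoetherian X], Scheme.IsQuasiExcellent X →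
      (∀ x : X, CharZero (X.residueField x)) →
      ∀ (D : X.IdealSheafData), IsEffectiveCartier D →
        (Scheme.regularLocus X)ᶜ ⊆ (D.support : Set X) →
        (∃ (k : Type u) (_ : Field k) (q : D.subscheme ⟶ Spec (.of k)),
            LocallyOfFiniteType q ∧ QuasiCompact q) →
        ∃ (X'' : Scheme.{u}) (f : X'' ⟶ X) (J : X.IdealSheafData),
          IsBlowup f J ∧ (J.support : Set X) ⊆ D.support ∧ Scheme.IsRegular X'') :
    Hironaka1964_local.{u} :=
  hironaka1964_local_of_isBlowup_local fun S _ _ _ hS h0 _S' _g _I hg hI hsing =>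
    isBlowup_local_of_cartier hC S hS h0 hg hI hsing

end Literature.AlgebraicGeometry.Resolution

end
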